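import Summits.Ventures.Crystal3D.Bulk.CapCutCheck
import Summits.Ventures.PackingBounds.ThreePointCert.CheckKron
import Summits.Ventures.PackingBounds.ThreePointCert.CheckDim3
import HarnessLib

/-!
# Cap-cut certificates: a kernel CHECKER for both polynomial inequalities by sum-of-squares identities (definitions)

Venture `Crystal3D` (cell `pub-crystal3d`, phase 2; seat p2). A cap certificate
(`Literature.Geometry.DiscreteGeometry.BachocVallentin.CapCert`: cap level `u₀`, row bases `W`, PSD
factors `L_k`; [BachocVallentin2009, Theorem 4.4], `n = 3`) proves `CapCodeBound u₀` once
(I) `K(u,u,1) ≤ D` on `[u₀, 1]` and (II) `K(u,v,t) ≤ -λ` on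
`Δ = [u₀,1]² × [-1,½] ∩ {1 + 2uvt - u² - v² - t² ≥ 0}` hold with `D < 11λ` (`CapCut.capCodeBound_of_capCert`,
seat p3). `Bulk/CapCutCheck.lean` makes (I) a kernel computation by Taylor boxes and leaves (II) a hypothesis.
THIS FILE makes (I) AND (II) kernel computations WITHOUT subdivision, by Putinar-type identities in
exact integer arithmetic, reusing the tree's reflective polynomial library (`PolyCert.SPoly`, the
Kronecker-packed Gram validation `ThreePointCert.CheckKron`, the `S²` three-point table `CheckDim3.QI3`):

* `capFPoly` — the integer expansion `KI = DK · K` of a cap kernel from integer weight vectors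
  (`Σ_k s_k (Σ_r φ_{k,r}(u) φ_{k,r}(v)) · QI3 k`, no symmetrisation), its value `capFval`, block-chunk
  check `capFchunkOK` + composition (`CapFChunkVal`), and the LINK to a `CapCert` (`linkCheck`:
  `g_{k,r} = φ_{k,r}/N_k` as coefficient lists and `s_k · c_k · N_k² = DK`) with
  `capFval_link : capFval (blocks) = DK · c.kernel`;
* `SOSCert` — the integer certificate: a dyadic rounding `K' = KpI/2^B0` of `K` with the bridge
  `Σ|2^B0 KI - DK·KpI| ≤ delB` (so `|K - K'| ≤ delB/(DK 2^B0)` on the unit box), and the identities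
  (II) `Λ₂(-K' - LamD/2^B0) - c₂ ≡ E0 + s₁E1 + s₂E2 + m_t E3 + gram·E4 (± c₂)`,
  (I)  `Λ₁(DpI/2^B0 - K'(u,u,1)) - c₁ ≡ Q0 + m_u Q1 (± c₁)`,
  with `m_u = (q₀u + p₀)(1-u)` (`u₀ = -p₀/q₀`), `s₁ = m_u + m_v`, `s₂ = m_u m_v`, `m_t = (1+t)(1-2t)`,
  `gram = 1 + 2uvt - u² - v² - t²`, and `E0 … Q1` validated Gram expansions `zᵀ(LLᵀ)z ≥ 0`;
* the soundness theorems (`ineqII_of_capSOS`, `ineqI_of_capSOS`, `capCodeBound_of_capSOS`) are in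
  `TopCut/CapSOSSound.lean`.

Everything computational is plain `List`/`ℤ`/`ℕ` structural recursion (`decide +kernel`, standard
axioms). HONEST FRAMING: a checker and its soundness; NO certificate is asserted in this file.
-/

noncomputable section

open Finset
open Literature.Geometry.DiscreteGeometry Literature.Geometry.DiscreteGeometry.PolyCert
open Literature.Geometry.DiscreteGeometry.PolyCert.SPoly
open Literature.Geometry.DiscreteGeometry.BachocVallentin
open Summit.Ventures.PackingBounds.ThreePointCert

namespace Summit.Ventures.Crystal3D.CapSOS

/-! ### The integer expansion of a cap kernel -/

/-- One block of an integer cap-kernel expansion: degree `k`, integer scale `s`, integer weight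
vectors (coefficient lists in `u`, low degree first). [folklore] -/
structure CapBlk where
  /-- the degree `k` of the Chebyshev kernel `Q3 k` -/
  k : ℕ
  /-- integer scale `s_k` -/
  s : ℕ
  /-- weight vectors `φ_{k,r}` -/
  ws : List (List ℤ)
deriving DecidableEq

/-- `φ_w(u) = Σ_a w_a u^a` as a term list. [folklore] -/
def phiU (w : List ℤ) : SPoly := (List.range w.length).map fun a => (⟨a, 0, 0⟩, w.getD a 0)

/-- `φ_w(v) = Σ_b w_b v^b` as a term list. [folklore] -/
def phiV (w : List ℤ) : SPoly := (List.range w.length).map fun b => (⟨0, b, 0⟩, w.getD b 0)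

/-- One block: `s · (Σ_w φ_w(u) φ_w(v)) · QI3 k` (the Chebyshev table `QI3 k` is built once per block).
[folklore] -/
def capFb (b : CapBlk) : SPoly :=
  smul (b.s : ℤ) (mulN (mergeAll (b.ws.map fun w => mulN (phiU w) (phiV w))) (QI3 b.k))

/-- The integer expansion of a list of blocks. [folklore] -/
def capFPoly (bs : List CapBlk) : SPoly := mergeAll (bs.map capFb)

/-- Block-chunk check: `Dprev + capFPoly bs - Dnext ≡ 0`. [folklore] -/
def capFchunkOK (bs : List CapBlk) (Dprev Dnext : SPoly) : Bool :=
  residualBound (Dprev ++ capFPoly bs ++ neg Dnext) 0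

/-- The real value of the expansion: `Σ_b s_b c_{k_b} Σ_w φ_w(u) φ_w(v) Q3 k_b (u,v,t)`. [folklore] -/
def capFval (bs : List CapBlk) (u v t : ℝ) : ℝ :=
  (bs.map fun b => ((b.s * cfac3 b.k : ℕ) : ℝ) *
    (b.ws.map fun w => phiW w u * phiW w v * Q3 b.k u v t).sum).sum

/-- `eval (phiU w) = φ_w(u)`. [folklore] -/
theorem eval_phiU (w : List ℤ) (u v t : ℝ) : eval (phiU w) u v t = phiW w u := by
  rw [phiU, SPoly.eval, List.map_map, list_sum_map_range, phiW]
  refine Finset.sum_congr rfl fun a _ => ?_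
  simp [Mono.eval]

/-- `eval (phiV w) = φ_w(v)`. [folklore] -/
theorem eval_phiV (w : List ℤ) (u v t : ℝ) : eval (phiV w) u v t = phiW w v := by
  rw [phiV, SPoly.eval, List.map_map, list_sum_map_range, phiW]
  refine Finset.sum_congr rfl fun b _ => ?_
  simp [Mono.eval]

/-- `eval (capFb b) = s · c_k · Σ_w φ_w(u) φ_w(v) Q3 k`. [folklore] -/
theorem eval_capFb (b : CapBlk) (u v t : ℝ) :
    eval (capFb b) u v t =
      ((b.s * cfac3 b.k : ℕ) : ℝ) * (b.ws.map fun w => phiW w u * phiW w v * Q3 b.k u v t).sum := by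
  rw [capFb, eval_smul, eval_mulN, eval_mergeAll, List.map_map, eval_QI3]
  have e : (b.ws.map ((fun p => eval p u v t) ∘ fun w => mulN (phiU w) (phiV w))).sum
      = (b.ws.map fun w => phiW w u * phiW w v).sum := by
    exact congrArg List.sum (List.map_congr_left fun w _ => by
      simp only [Function.comp_apply, eval_mulN, eval_phiU, eval_phiV])
  rw [e]
  have e2 : (b.ws.map fun w => phiW w u * phiW w v * Q3 b.k u v t).sum
      = (b.ws.map fun w => phiW w u * phiW w v).sum * Q3 b.k u v t := by
    rw [← List.sum_map_mul_right]
  rw [e2]; push_cast; ring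

/-- `eval (capFPoly bs) = capFval bs`. [folklore] -/
theorem eval_capFPoly (bs : List CapBlk) (u v t : ℝ) :
    eval (capFPoly bs) u v t = capFval bs u v t := by
  rw [capFPoly, eval_mergeAll, List.map_map, capFval]
  exact congrArg List.sum (List.map_congr_left fun b _ => by
    simp only [Function.comp_apply]; rw [eval_capFb])

/-- `capFPoly` is additive in the block list (on values). [folklore] -/
theorem eval_capFPoly_append (l₁ l₂ : List CapBlk) (u v t : ℝ) :
    eval (capFPoly (l₁ ++ l₂)) u v t = eval (capFPoly l₁) u v t + eval (capFPoly l₂) u v t := by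
  simp [capFPoly, eval_mergeAll, List.map_append, List.sum_append]

/-- Block-chunk validity on values: `Dnext = Dprev + capFPoly bs` on the unit box. [folklore] -/
def CapFChunkVal (bs : List CapBlk) (Dprev Dnext : SPoly) : Prop :=
  ∀ u v t : ℝ, |u| ≤ 1 → |v| ≤ 1 → |t| ≤ 1 →
    eval Dnext u v t = eval Dprev u v t + eval (capFPoly bs) u v t

/-- A kernel block-chunk check gives chunk validity. [folklore] -/
theorem capFChunkVal_of_ok (bs : List CapBlk) (Dprev Dnext : SPoly)
    (h : capFchunkOK bs Dprev Dnext = true) : CapFChunkVal bs Dprev Dnext := by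
  intro u v t hu hv ht
  have h0 := abs_eval_le_of_residualBound _ _ h hu hv ht
  rw [eval_append, eval_append, eval_neg] at h0
  have h1 : |Dprev.eval u v t + (capFPoly bs).eval u v t + -Dnext.eval u v t| ≤ 0 := by
    simpa using h0
  have h2 := abs_nonpos_iff.1 h1
  linarith

/-- Consecutive block chunks compose. [folklore] -/
theorem capFChunkVal_append (l₁ l₂ : List CapBlk) (D0 D1 D2 : SPoly)
    (h1 : CapFChunkVal l₁ D0 D1) (h2 : CapFChunkVal l₂ D1 D2) : CapFChunkVal (l₁ ++ l₂) D0 D2 := by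
  intro u v t hu hv ht
  rw [h2 u v t hu hv ht, h1 u v t hu hv ht, eval_capFPoly_append]; ring

/-- Validity of an expansion `KI` w.r.t. a block list: `KI = capFPoly bs` on the unit box. [folklore] -/
def CapFValid (bs : List CapBlk) (KI : SPoly) : Prop :=
  ∀ u v t : ℝ, |u| ≤ 1 → |v| ≤ 1 → |t| ≤ 1 → eval KI u v t = capFval bs u v t

/-- A full-range chunk validity is a validity. [folklore] -/
theorem capFValid_of_chunkVal (bs bs' : List CapBlk) (KI : SPoly) (hbs : bs' = bs)
    (h : CapFChunkVal bs' [] KI) : CapFValid bs KI := by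
  intro u v t hu hv ht
  rw [h u v t hu hv ht, eval_nil, zero_add, hbs, eval_capFPoly]

/-! ### The link to a `CapCert` -/

/-- Link data: per-block denominators `N_k`, scales `s_k`, and the integer weight vectors
`Φ[k][r] = N_k · g_{k,r}` (coefficient lists). [folklore] -/
structure CapLink where
  /-- `N_k` -/
  N : List ℕ
  /-- `s_k` -/
  S : List ℕ
  /-- `Φ[k][r]` -/
  Phi : List (List (List ℤ))

/-- The block list a link defines for `K` blocks and column bound `R`. [folklore] -/
def CapLink.blocks (L : CapLink) (K R : ℕ) : List CapBlk :=
  (List.range K).map fun k => ⟨k, L.S.getD k 0, (List.range R).map fun r => (L.Phi.getD k []).getD r []⟩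

/-- `eqScaled N w l`: the rational coefficient list `l` equals `w / N` as a polynomial
(zero-padded on either side). Structural recursion on `w`. [folklore] -/
def eqScaled (N : ℕ) : List ℤ → List ℚ → Bool
  | [], l => l.all fun q => q == 0
  | z :: zs, l => (l.headD 0 * N == z) && eqScaled N zs l.tail

/-- `φ_{z :: w}(u) = z + u · φ_w(u)`. [folklore] -/
theorem phiW_cons (z : ℤ) (w : List ℤ) (u : ℝ) : phiW (z :: w) u = z + u * phiW w u := by
  unfold phiW
  rw [List.length_cons, Finset.sum_range_succ']
  simp only [List.getD_cons_succ, List.getD_cons_zero, pow_zero, mul_one, pow_succ]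
  rw [Finset.mul_sum]
  have : ∀ a ∈ Finset.range w.length,
      (w.getD a 0 : ℝ) * (u ^ a * u) = u * ((w.getD a 0 : ℝ) * u ^ a) := fun a _ => by ring
  rw [Finset.sum_congr rfl this]; ring

/-- `φ_[] = 0`. [folklore] -/
theorem phiW_nil (u : ℝ) : phiW [] u = 0 := by simp [phiW]

/-- Horner step of `upolyEval` through `headD`/`tail`. [folklore] -/
theorem upolyEval_headD_tail (l : List ℚ) (u : ℝ) :
    upolyEval l u = ((l.headD 0 : ℚ) : ℝ) + u * upolyEval l.tail u := by
  cases l with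
  | nil => simp [upolyEval]
  | cons c cs => simp [upolyEval]

/-- An all-zero coefficient list evaluates to `0`. [folklore] -/
theorem upolyEval_eq_zero_of_all (l : List ℚ) (h : (l.all fun q => q == 0) = true) (u : ℝ) :
    upolyEval l u = 0 := by
  induction l with
  | nil => simp [upolyEval]
  | cons c cs ih =>
    simp only [List.all_cons, Bool.and_eq_true, beq_iff_eq] at h
    rw [upolyEval, h.1, ih h.2]; simp

/-- Soundness of `eqScaled`: `upolyEval l u = φ_w(u) / N`. [folklore] -/
theorem upolyEval_of_eqScaled (N : ℕ) (hN : 0 < N) :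
    ∀ (w : List ℤ) (l : List ℚ), eqScaled N w l = true → ∀ u : ℝ, upolyEval l u = phiW w u / N := by
  intro w
  induction w with
  | nil =>
    intro l h u
    rw [eqScaled] at h
    rw [upolyEval_eq_zero_of_all l h u, phiW_nil, zero_div]
  | cons z zs ih =>
    intro l h u
    simp only [eqScaled, Bool.and_eq_true, beq_iff_eq] at h
    have hN' : (N : ℝ) ≠ 0 := by exact_mod_cast hN.ne'
    rw [upolyEval_headD_tail, ih l.tail h.2 u, phiW_cons]
    have e : ((l.headD 0 : ℚ) : ℝ) = (z : ℝ) / N := by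
      rw [eq_div_iff hN']
      have := h.1
      exact_mod_cast this
    rw [e, add_div, mul_div_assoc]

/-- The LINK CHECK of a `CapCert` against link data and the global denominator `DK`:
for every `k < |L|`: `0 < N_k`, `s_k · c_k · N_k² = DK`, and for every `r < R`,
`g_{k,r} = Φ[k][r] / N_k` as coefficient lists (`CapCut.gPolyN`). [folklore] -/
def linkCheck (c : CapCert) (L : CapLink) (DK : ℕ) : Bool :=
  (List.range c.L.length).all fun k =>
    decide (0 < L.N.getD k 0) && decide (L.S.getD k 0 * cfac3 k * L.N.getD k 0 ^ 2 = DK) &&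
    ((List.range c.R).all fun r =>
      eqScaled (L.N.getD k 0) ((L.Phi.getD k []).getD r []) (CapCut.gPolyN c k r (c.rows k)))

/-- **The link**: under `linkCheck`, the value of the integer expansion is `DK · K`. [folklore] -/
theorem capFval_link (c : CapCert) (L : CapLink) (DK : ℕ) (h : linkCheck c L DK = true)
    (u v t : ℝ) : capFval (L.blocks c.L.length c.R) u v t = (DK : ℝ) * c.kernel u v t := by
  simp only [linkCheck, List.all_eq_true, List.mem_range, Bool.and_eq_true, decide_eq_true_eq] at h
  rw [CapCert.kernel, capKernel3, Finset.mul_sum, capFval, CapLink.blocks, List.map_map, list_sum_map_range]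
  refine Finset.sum_congr rfl fun k hk => ?_
  rw [Finset.mem_range] at hk
  obtain ⟨⟨hN, hS⟩, hr⟩ := h k hk
  simp only [Function.comp_apply, List.map_map]
  rw [list_sum_map_range, Finset.mul_sum, Finset.mul_sum]
  refine Finset.sum_congr rfl fun r hr' => ?_
  rw [Finset.mem_range] at hr'
  have hg : ∀ x : ℝ, c.g k r x = phiW ((L.Phi.getD k []).getD r []) x / (L.N.getD k 0 : ℕ) := by
    intro x
    rw [← CapCut.eval_gPolyN_rows]
    exact upolyEval_of_eqScaled _ hN _ _ (hr r hr') x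
  simp only [Function.comp_apply]
  rw [hg u, hg v]
  have hN' : ((L.N.getD k 0 : ℕ) : ℝ) ≠ 0 := by exact_mod_cast hN.ne'
  have hS' : ((L.S.getD k 0 * cfac3 k : ℕ) : ℝ) * ((L.N.getD k 0 : ℕ) : ℝ) ^ 2 = (DK : ℝ) := by
    exact_mod_cast hS
  rw [← hS']
  field_simp

/-! ### The integer certificate -/

/-- An SOS cap certificate in integers (see the module docstring for the semantics). [folklore] -/
structure SOSCert where
  /-- `u₀ = -p₀/q₀` -/
  p0 : ℕ
  /-- see `p0` -/
  q0 : ℕ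
  /-- dyadic scale of `K'` and of the constants -/
  B0 : ℕ
  /-- `(λ + δ) · 2^B0` -/
  LamD : ℕ
  /-- `D' · 2^B0` -/
  DpI : ℕ
  /-- bridge slack `Σ|2^B0 KI - DK KpI|` -/
  delB : ℕ
  /-- scale of (II) divided by `2^B0` -/
  lam2 : ℕ
  /-- scale of (I) divided by `2^B0` -/
  lam1 : ℕ
  /-- `2^B0 · K'` -/
  KpI : SPoly
  /-- residual slack of (II) -/
  c2 : ℕ
  /-- residual slack of (I) -/
  c1 : ℕ
  /-- Gram expansion, multiplier `1` of (II) -/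
  E0 : SPoly
  /-- Gram expansion, multiplier `s₁ = m_u + m_v` -/
  E1 : SPoly
  /-- Gram expansion, multiplier `s₂ = m_u m_v` -/
  E2 : SPoly
  /-- Gram expansion, multiplier `m_t` -/
  E3 : SPoly
  /-- Gram expansion, multiplier `gram` -/
  E4 : SPoly
  /-- Gram expansion, multiplier `1` of (I) -/
  Q0 : SPoly
  /-- Gram expansion, multiplier `m_u` of (I) -/
  Q1 : SPoly

namespace SOSCert

/-- `m_u = (q₀u + p₀)(1 - u) = p₀ + (q₀ - p₀)u - q₀u²`. [folklore] -/
def mIu (S : SOSCert) : SPoly := [(⟨0, 0, 0⟩, (S.p0 : ℤ)), (⟨1, 0, 0⟩, (S.q0 : ℤ) - S.p0), (⟨2, 0, 0⟩, -(S.q0 : ℤ))]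

/-- `eval mIu = (q₀u + p₀)(1 - u)`. [folklore] -/
theorem eval_mIu (S : SOSCert) (u v t : ℝ) :
    eval S.mIu u v t = ((S.q0 : ℝ) * u + S.p0) * (1 - u) := by
  simp [mIu, eval, Mono.eval]; ring

/-- Target of (II): `lam2 · (-(KpI + LamD))`. [folklore] -/
def target2 (S : SOSCert) : SPoly := smul (S.lam2 : ℤ) (neg (S.KpI ++ C (S.LamD : ℤ)))

/-- Sum-of-squares side of (II). [folklore] -/
def rhs2 (S : SOSCert) : SPoly :=
  mergeAll [S.E0, mulN (S.mIu ++ permBAC S.mIu) S.E1, mulN (mulN S.mIu (permBAC S.mIu)) S.E2,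
    mulN ptT S.E3, mulN p4 S.E4]

/-- The check of (II). [folklore] -/
def check2 (S : SOSCert) : Bool :=
  residualBound (mergeAll [S.target2, neg S.rhs2, neg (C (S.c2 : ℤ))]) S.c2

/-- Target of (I): `lam1 · (DpI - KpI(u,u,1))`. [folklore] -/
def target1 (S : SOSCert) : SPoly := smul (S.lam1 : ℤ) (C (S.DpI : ℤ) ++ neg (substUU1 S.KpI))

/-- Sum-of-squares side of (I). [folklore] -/
def rhs1 (S : SOSCert) : SPoly := mergeAll [S.Q0, mulN S.mIu S.Q1]

/-- The check of (I). [folklore] -/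
def check1 (S : SOSCert) : Bool :=
  residualBound (mergeAll [S.target1, neg S.rhs1, neg (C (S.c1 : ℤ))]) S.c1

/-- The bridge check between the exact expansion `KI` (`= DK·K`) and the dyadic `KpI` (`= 2^B0 K'`):
`Σ|2^B0 KI - DK KpI| ≤ delB`. [folklore] -/
def bridge (S : SOSCert) (DK : ℕ) (KI : SPoly) : Bool :=
  residualBound (smul (2 ^ S.B0 : ℤ) KI ++ neg (smul (DK : ℤ) S.KpI)) S.delB

/-- Side conditions for `IneqII … lam`: `0 < q₀`, `p₀ ≤ q₀`, `c.u₀ = -p₀/q₀`, `0 < DK`, `0 < lam2`,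
and `lam · DK · 2^B0 ≤ LamD · DK - delB`. [folklore] -/
def side2 (S : SOSCert) (c : CapCert) (DK : ℕ) (lam : ℚ) : Bool :=
  decide (0 < S.q0) && decide (S.p0 ≤ S.q0) && decide (c.u0 = -(S.p0 : ℚ) / S.q0) && decide (0 < DK) &&
    decide (0 < S.lam2) &&
    decide (lam * ((DK * 2 ^ S.B0 : ℕ) : ℚ) ≤ ((S.LamD * DK : ℕ) : ℚ) - S.delB)

/-- Side conditions for `IneqI … D`: `0 < q₀`, `p₀ ≤ q₀`, `c.u₀ = -p₀/q₀`, `0 < DK`, `0 < lam1`,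
and `DpI · DK + delB ≤ D · DK · 2^B0`. [folklore] -/
def side1 (S : SOSCert) (c : CapCert) (DK : ℕ) (D : ℚ) : Bool :=
  decide (0 < S.q0) && decide (S.p0 ≤ S.q0) && decide (c.u0 = -(S.p0 : ℚ) / S.q0) && decide (0 < DK) &&
    decide (0 < S.lam1) &&
    decide (((S.DpI * DK + S.delB : ℕ) : ℚ) ≤ D * ((DK * 2 ^ S.B0 : ℕ) : ℚ))

end SOSCert

end Summit.Ventures.Crystal3D.CapSOS

end
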